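import Summits.AtomisticToContinuum.BoseEinsteinCondensation.Theorems.BECCutLineWeakDisorderGroundStateRigidityStubCompactness
import Summits.AtomisticToContinuum.BoseEinsteinCondensation.Theorems.BECCutLineWeakDisorderGroundStateRigidityStubRigidityOfUnique
import Summits.AtomisticToContinuum.BoseEinsteinCondensation.Theorems.BECCutLineWeakDisorderGroundStateRigidityStubFiniteEnergyLowDensity
import Summits.AtomisticToContinuum.BoseEinsteinCondensation.Theorems.BECCutLineWeakDisorderGroundStateRigidityStubExistsNonnegGroundState
import Summits.AtomisticToContinuum.BoseEinsteinCondensation.Theorems.BECCutLineWeakDisorderGroundStateRigidityEssBounded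
import Literature.MathematicalPhysics.QuantumManyBody.BoseGasDirichletWall
import Summits.AtomisticToContinuum.BoseEinsteinCondensation.Theorems.BECCutLineWeakDisorderGroundStateRigidityStubLincombGroundState
import Summits.AtomisticToContinuum.BoseEinsteinCondensation.Theorems.BECCutLineWeakDisorderGroundStateRigidityStubUniqueOfPos
import Summits.AtomisticToContinuum.BoseEinsteinCondensation.Theorems.BECCutLineWeakDisorderGroundStateRigidityStubPairCutoff
import Summits.AtomisticToContinuum.BoseEinsteinCondensation.Theorems.BECCutLineWeakDisorderGroundStateRigidityStubTruncHigh
import Summits.AtomisticToContinuum.BoseEinsteinCondensation.Theorems.BECCutLineWeakDisorderGroundStateRigidityStubEnergyTrunc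
import Summits.AtomisticToContinuum.BoseEinsteinCondensation.Theorems.BECCutLineWeakDisorderGroundStateRigidityStubClosedJensen
import Summits.AtomisticToContinuum.BoseEinsteinCondensation.Theorems.BECCutLineWeakDisorderGroundStateRigidityStubLocalTube
import Summits.AtomisticToContinuum.BoseEinsteinCondensation.Theorems.BECCutLineWeakDisorderGroundStateRigidityStubPosOfTrunc
import HarnessLib

/-!
# Crux `GroundStateRigidity` (stmt-AtomisticToContinuum-9072), line `Sketch`:
# class (a) of the kernel — potentials (essentially) locally bounded on `(0, ∞)` — CLOSED

Supports (does not close) stmt-AtomisticToContinuum-9072 (lead c2). Assembly of the eight landed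
stubs 6–13 of skeleton v4 (`stub_lincombGroundState`, `stub_uniqueOfPos`, `stub_pairCutoff`,
`stub_truncHigh`, `stub_energyTrunc`, `stub_closedJensen`, `stub_localTube`, `stub_posOfTrunc`) with the
cycle-1 stubs (`stub_compactness`, `stub_rigidityOfUnique`, `stub_finiteEnergyLowDensity`,
`stub_existsNonnegGroundState`) and the null-set-of-radii transfer (`…EssBounded`):

* `hasUniqueGroundState_of_locBdd` — for `N ≥ 1`, `L > 0`, `v` measurable and bounded on every
  `[r, ∞)`, `r > 0` (ANY behaviour as `r → 0`: soft cores `r⁻ⁿ`, `v(0) = ⊤`, `exp(exp(1/r))`, …) and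
  `E₀(N, L) < ⊤`, the closed-form ground state is unique up to phase — at EVERY density (truncation
  `v ⊓ n ↑ v`: energy truncation, closed-form Jensen, `n`-uniform local tube bound, Fatou ⇒ a.e.
  positivity; positivity ⇒ uniqueness by the sign argument on the cone of minimisers);
* `hasUniqueGroundState_of_essLocBdd` — the same under the ESSENTIAL hypothesis
  `∀ r > 0, ∃ C, v ≤ C` a.e. on `[r, ∞)` (null sets of radii are invisible);
* `rigid_of_essLocBdd` — hence rigidity of near-minimisers at every such finite-energy box;
* `groundStateRigidity_of_essLocBdd` — **the crux `GroundStateRigidity` for every admissible `v` of class (a)**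
  (essentially locally bounded on `(0, ∞)`; the kernel class that leads -0/c1 sized as an XL re-run of the
  Feynman–Kac package for singular `V`, here a consequence of the bounded-`v` package; low density enters only
  through `E₀ < ⊤` eventually, `stub_finiteEnergyLowDensity`). The companion file `…LocBddAllDensities.lean`
  removes even that (finite energy at every `(N ≥ 1, L > 0)`, `groundStateEnergy_ne_top_of_locBdd`).

What remains open of the crux is exactly class (b/c): `v` essentially unbounded on some `[r, ∞)`,
`r > 0` (hard spheres of positive diameter, hollow shells, annular walls) — skeleton v4's
`stub_uniquenessKernelWall`.

## References

* M. Reed, B. Simon, *Methods of Modern Mathematical Physics IV* (1978), §XIII.12 Thms XIII.44–47.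
* W. G. Faris, B. Simon, Degenerate and non-degenerate ground states for Schrödinger operators, Duke
  Math. J. 42 (1975) 559–567.
-/

noncomputable section

open MeasureTheory Filter Set
open scoped ENNReal NNReal Topology

namespace Summit.AtomisticToContinuum.BoseEinsteinCondensation.Theorems.GroundStateRigidity

open Literature.MathematicalPhysics.QuantumManyBody.BoseGas

/-- **Uniqueness of the ground state for potentials locally bounded on `(0, ∞)` (class (a)), at every
`(N ≥ 1, L > 0)` with `E₀ < ⊤`.** Existence of a nonnegative ground state (`stub_existsNonnegGroundState`
with `stub_compactness`), a.e. positivity of every nonnegative ground state (`stub_posOfTrunc` fed with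
`stub_energyTrunc ← stub_pairCutoff, stub_truncHigh` and `stub_closedJensen`, `stub_localTube`), and
uniqueness from positivity (`stub_uniqueOfPos` fed with `stub_lincombGroundState`).
[cite: ReedSimonIV1978, §XIII.12 Thms XIII.46–XIII.47] -/
theorem hasUniqueGroundState_of_locBdd :
    ∀ (N : ℕ) (v : ℝ → ℝ≥0∞) (L : ℝ), 1 ≤ N → 0 < L → Measurable v →
      (∀ r : ℝ, 0 < r → ∃ C : ℝ≥0, ∀ s : ℝ, r ≤ s → v s ≤ C) →
      groundStateEnergy v N L ≠ ⊤ → HasUniqueGroundState v N L :=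
  fun N v L hN hL hv hlb hE =>
    stub_uniqueOfPos stub_lincombGroundState N v L
      (stub_existsNonnegGroundState stub_compactness N v L hE)
      (stub_posOfTrunc stub_closedJensen stub_localTube N v L hN hL hv hlb
        (stub_energyTrunc stub_pairCutoff stub_truncHigh N v L hN hL hv hlb))

/-- Off a null set of radii, an essentially-locally-bounded `v` agrees with a measurable `v'` that is
locally bounded on `(0, ∞)` pointwise (`v' = 0` on the union of the exceptional null sets at the radii
`1/(k+1)`). [folklore] -/
theorem exists_locBdd_offNull {v : ℝ → ℝ≥0∞} (hv : Measurable v)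
    (hlb : ∀ r : ℝ, 0 < r → ∃ C : ℝ≥0, ∀ᵐ s : ℝ, r ≤ s → v s ≤ C) :
    ∃ (v' : ℝ → ℝ≥0∞) (S : Set ℝ), Measurable v' ∧ MeasurableSet S ∧ volume S = 0 ∧
      (∀ r, r ∉ S → v r = v' r) ∧
      (∀ r : ℝ, 0 < r → ∃ C : ℝ≥0, ∀ s : ℝ, r ≤ s → v' s ≤ C) := by
  have hk : ∀ k : ℕ, (0 : ℝ) < 1 / ((k : ℝ) + 1) := fun k => Nat.one_div_pos_of_nat
  choose C hC using fun k : ℕ => hlb (1 / ((k : ℝ) + 1)) (hk k)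
  set S : Set ℝ := ⋃ k : ℕ, {s : ℝ | 1 / ((k : ℝ) + 1) ≤ s ∧ (C k : ℝ≥0∞) < v s} with hSdef
  have hSk : ∀ k : ℕ, MeasurableSet {s : ℝ | 1 / ((k : ℝ) + 1) ≤ s ∧ (C k : ℝ≥0∞) < v s} := fun k =>
    (measurableSet_le measurable_const measurable_id).inter (measurableSet_lt measurable_const hv)
  have hSm : MeasurableSet S := MeasurableSet.iUnion hSk
  have hS0 : volume S = 0 := by
    refine (measure_iUnion_null_iff).2 fun k => ?_
    rw [measure_eq_zero_iff_ae_notMem]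
    filter_upwards [hC k] with s hs
    simp only [not_and, not_lt]
    exact hs
  classical
  refine ⟨fun r => if r ∈ S then 0 else v r, S, ?_, hSm, hS0, fun r hr => by simp [hr], fun r hr => ?_⟩
  · exact Measurable.ite hSm measurable_const hv
  · obtain ⟨k, hk'⟩ := exists_nat_one_div_lt hr
    refine ⟨C k, fun s hs => ?_⟩
    by_cases hsS : s ∈ S
    · simp [hsS]
    · simp only [hsS, if_false]
      have hnot : ¬ (1 / ((k : ℝ) + 1) ≤ s ∧ (C k : ℝ≥0∞) < v s) := fun h =>
        hsS (Set.mem_iUnion.2 ⟨k, h⟩)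
      exact not_lt.1 fun hlt => hnot ⟨hk'.le.trans hs, hlt⟩

/-- **Uniqueness for ESSENTIALLY locally bounded potentials**: for `N ≥ 1`, `L > 0`, `v` measurable
with `v ≤ C(r)` for a.e. radius in `[r, ∞)` (every `r > 0`) and `E₀ < ⊤`, the ground state is unique up
to phase (null sets of radii are invisible: `hasUniqueGroundState_iff_offNull`,
`groundStateEnergy_congr_offNull`). [cite: ReedSimonIV1978, §XIII.12 Thm XIII.47] -/
theorem hasUniqueGroundState_of_essLocBdd :
    ∀ (N : ℕ) (v : ℝ → ℝ≥0∞) (L : ℝ), 1 ≤ N → 0 < L → Measurable v →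
      (∀ r : ℝ, 0 < r → ∃ C : ℝ≥0, ∀ᵐ s : ℝ, r ≤ s → v s ≤ C) →
      groundStateEnergy v N L ≠ ⊤ → HasUniqueGroundState v N L := by
  intro N v L hN hL hv hlb hE
  obtain ⟨v', S, hv'm, hSm, hS0, hvv', hlb'⟩ := exists_locBdd_offNull hv hlb
  have hE' : groundStateEnergy v' N L ≠ ⊤ := by
    rwa [← groundStateEnergy_congr_offNull hSm hS0 hvv' N L]
  exact (hasUniqueGroundState_iff_offNull hSm hS0 hvv').2
    (hasUniqueGroundState_of_locBdd N v' L hN hL hv'm hlb' hE')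

/-- **Rigidity of near-minimisers for essentially locally bounded potentials, at every finite-energy
box**: for `N ≥ 1`, `L > 0`, `v` measurable with `v ≤ C(r)` a.e. on `[r, ∞)` (every `r > 0`) and
`E₀(N, L) < ⊤`, for every `η > 0` some `δ > 0` makes any two `δ`-near-minimisers `η`-close in `L²` up
to a phase (uniqueness + compactness, `stub_rigidityOfUnique`). [cite: ReedSimonIV1978, §XIII.12 Thm XIII.47] -/
theorem rigid_of_essLocBdd :
    ∀ (N : ℕ) (v : ℝ → ℝ≥0∞) (L : ℝ), 1 ≤ N → 0 < L → Measurable v →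
      (∀ r : ℝ, 0 < r → ∃ C : ℝ≥0, ∀ᵐ s : ℝ, r ≤ s → v s ≤ C) →
      groundStateEnergy v N L ≠ ⊤ →
      ∀ η : ℝ, 0 < η → ∃ δ : ℝ≥0∞, 0 < δ ∧ ∀ Ψ Φ : TrialState N L,
        energy v Ψ ≤ groundStateEnergy v N L + δ → energy v Φ ≤ groundStateEnergy v N L + δ →
        ∃ c : ℂ, ‖c‖ = 1 ∧ ∫⁻ X, (‖Ψ.ψ X - c * Φ.ψ X‖₊ : ℝ≥0∞) ^ 2 ≤ ENNReal.ofReal η :=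
  fun N v L hN hL hv hlb hE =>
    stub_rigidityOfUnique stub_compactness v N L
      (hasUniqueGroundState_of_essLocBdd N v L hN hL hv hlb hE)

/-- **`GroundStateRigidity` for every admissible potential that is ESSENTIALLY LOCALLY BOUNDED on
`(0, ∞)`** (class (a) of the crux's kernel — no wall at a positive radius; arbitrary at `r → 0`): for a
repulsive finite-range `v` with `v ≤ C(r)` a.e. on `[r, ∞)` for every `r > 0` there is `ρ₀ > 0` such that
for `0 < ρ < ρ₀`, all large `N` and every `η > 0` some `δ > 0` makes any two `δ`-near-minimisers in the
box of side `(N/ρ)^{1/3}` `η`-close in `L²` up to a phase. Low density enters only through `E₀ < ⊤`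
eventually (`stub_finiteEnergyLowDensity`); then `rigid_of_essLocBdd`.
[cite: ReedSimonIV1978, §XIII.12 Thms XIII.46–XIII.47] -/
theorem groundStateRigidity_of_essLocBdd :
    ∀ v : ℝ → ℝ≥0∞, IsRepulsiveFiniteRange v →
      (∀ r : ℝ, 0 < r → ∃ C : ℝ≥0, ∀ᵐ s : ℝ, r ≤ s → v s ≤ C) →
      ∃ ρ₀ : ℝ, 0 < ρ₀ ∧ ∀ ρ : ℝ, 0 < ρ → ρ < ρ₀ → ∀ᶠ N : ℕ in atTop,
        ∀ η : ℝ, 0 < η → ∃ δ : ℝ≥0∞, 0 < δ ∧ ∀ Ψ Φ : TrialState N (sideLength ρ N),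
          energy v Ψ ≤ groundStateEnergy v N (sideLength ρ N) + δ →
          energy v Φ ≤ groundStateEnergy v N (sideLength ρ N) + δ →
          ∃ c : ℂ, ‖c‖ = 1 ∧ ∫⁻ X, (‖Ψ.ψ X - c * Φ.ψ X‖₊ : ℝ≥0∞) ^ 2 ≤ ENNReal.ofReal η := by
  intro v hv hlb
  obtain ⟨ρ₁, hρ₁, h₁⟩ := stub_finiteEnergyLowDensity v hv
  refine ⟨ρ₁, hρ₁, fun ρ hρ hρ₁' => ?_⟩
  filter_upwards [h₁ ρ hρ hρ₁', eventually_ge_atTop 1] with N hE hN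
  exact rigid_of_essLocBdd N v (sideLength ρ N) hN (sideLength_pos_of_pos hρ hN) hv.1 hlb hE

end Summit.AtomisticToContinuum.BoseEinsteinCondensation.Theorems.GroundStateRigidity

end
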